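import Summits.KontsevichZagierPeriods.KontsevichZagierPeriods.Theses.SpheresForWalls
import Literature.NumberTheory.Transcendental.KZDominatedFamilyRelations
import Literature.NumberTheory.Transcendental.KZRegCalculus
import Summits.KontsevichZagierPeriods.KontsevichZagierPeriods.Theorems.InverseLandauTateLiftingPullback

/-!
# `WallFreeExactness` (stmt-KontsevichZagierPeriods-16398, route SpheresForWalls) — proof

EXACTNESS IS A MOVE ON WALL-FREE REPRESENTATIONS. If `R = [ℝᴹ⁺¹, f]` has domain all of `ℝᴹ⁺¹` and
`A` is `ℚ`-semialgebraic on `ℝᴹ⁺¹` with `∂ₜ A(x, t) = f(x, t)` everywhere and `A(x, t) → 0` as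
`t → ±∞` on every fibre, then `[R] ∈ KZ.relations`. Proof (three moves and a junk term):
(1) rule (2): compactify the last coordinate by the rational chart `t = φ(u) = u/(1 − u²)` of `(−1, 1)`
onto `ℝ` (`φ' = (1 + u²)/(1 − u²)²`, inverse `u = 2t/(1 + √(1 + 4t²))`): the honest pull-back
`R₁ = [ℝᴹ × (−1, 1), φ'(u)·f(x, φ u)]` exists and `[R] − [R₁]` is a relation (`tateLifting_pullback`,
Jacobian `diag(1, …, 1, φ'(u))`); (2) rule (1): `R₂ = [ℝᴹ × [−1, 1], same integrand]` differs from
`R₁` by the two null walls `{u = ±1}` (`KZ.IntegralRep.of_sub_of_restrict_mem_relations`; with Lean's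
`x/0 = 0` the pulled-back integrand is `0` on the walls, so it stays semialgebraic on the closed band);
(3) rule (3): ONE Newton–Leibniz move on the closed band over the base `ℝᴹ`, `a = −1`, `b = 1`, with
the primitive `G(x, u) = A(x, φ u)` EXTENDED BY ZERO to the walls — continuous on `[−1, 1]` by the two
limit hypotheses (`φ(u) → ±∞` as `u → ±1∓`), with derivative the pulled-back integrand on `(−1, 1)`
(chain rule), `ℚ`-semialgebraic (composition with the chart, `IsSemialgebraicFunOn.indicator`) — onto
the base `[ℝᴹ, 0]`; (4) `[ℝᴹ, 0]` is a relation (`KZ.of_mem_relations_of_eqOn_zero`).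
References: Kontsevich–Zagier, *Periods* (2001), §1.2; Bochnak–Coste–Roy (1998), §2.2.
-/
noncomputable section

open MeasureTheory Set Filter Topology
open Literature.NumberTheory.Transcendental
open Literature.ModelTheory.ExponentialFields (IsSemialgebraic isSemialgebraic_univ
  isSemialgebraic_setOf_eval_lt isSemialgebraic_setOf_eval_le)
open MvPolynomial (X C)

namespace Summit.KontsevichZagierPeriods.SpheresForWalls

namespace WallFree

variable {M : ℕ}

/-- `φ(u) = u/(1 − u²)` maps `(−1, 1)` ONTO `ℝ`: `φ(2t/(1 + √(1 + 4t²))) = t`. [folklore] -/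
theorem exists_phi_eq (t : ℝ) : ∃ u ∈ Ioo (-1 : ℝ) 1, u / (1 - u ^ 2) = t := by
  set s := Real.sqrt (1 + 4 * t ^ 2)
  have hs2 : s ^ 2 = 1 + 4 * t ^ 2 := Real.sq_sqrt (by positivity)
  have hts : 2 * |t| < 1 + s := by
    have : 2 * |t| ≤ s := Real.le_sqrt_of_sq_le (by nlinarith [sq_abs t])
    linarith
  have h1s : 0 < 1 + s := by linarith [Real.sqrt_nonneg (1 + 4 * t ^ 2)]
  refine ⟨2 * t / (1 + s), ?_, ?_⟩
  · rw [mem_Ioo, ← abs_lt, abs_div, abs_of_pos h1s, div_lt_one h1s, abs_mul, abs_two]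
    exact hts
  · have hden : 1 - (2 * t / (1 + s)) ^ 2 = 2 / (1 + s) := by
      field_simp
      linear_combination hs2
    rw [hden, div_div_eq_mul_div, div_mul_cancel₀ _ h1s.ne', mul_div_cancel_left₀ _ two_ne_zero]

/-- `φ` is injective on `(−1, 1)`: `φ u = φ v` forces `(u − v)(1 + uv) = 0` with `1 + uv > 0`.
[folklore] -/
theorem phi_injOn : InjOn (fun u : ℝ => u / (1 - u ^ 2)) (Ioo (-1) 1) := by
  intro u hu v hv h
  have hu1 : 0 < 1 - u ^ 2 := by nlinarith [hu.1, hu.2]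
  have hv1 : 0 < 1 - v ^ 2 := by nlinarith [hv.1, hv.2]
  have h' : u / (1 - u ^ 2) = v / (1 - v ^ 2) := h
  rw [div_eq_div_iff hu1.ne' hv1.ne'] at h'
  have h3 : (u - v) * (1 + u * v) = 0 := by linear_combination h'
  have h4 : 0 < 1 + u * v := by
    nlinarith [mul_pos (show 0 < 1 + u by linarith [hu.1]) (show 0 < 1 + v by linarith [hv.1]),
      mul_pos (show 0 < 1 - u by linarith [hu.2]) (show 0 < 1 - v by linarith [hv.2])]
  exact sub_eq_zero.1 ((mul_eq_zero.1 h3).resolve_right h4.ne')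

/-- `φ'(u) = (1 + u²)/(1 − u²)²` on `(−1, 1)`. [folklore] -/
theorem hasDerivAt_phi {u : ℝ} (hu : u ∈ Ioo (-1 : ℝ) 1) :
    HasDerivAt (fun u : ℝ => u / (1 - u ^ 2)) ((1 + u ^ 2) / (1 - u ^ 2) ^ 2) u := by
  have hu1 : 0 < 1 - u ^ 2 := by nlinarith [hu.1, hu.2]
  refine ((hasDerivAt_id' u).fun_div ((hasDerivAt_pow 2 u).const_sub 1) hu1.ne').congr_deriv ?_
  rw [div_left_inj' (pow_ne_zero 2 hu1.ne')]
  simp only [Nat.cast_ofNat, show (2 : ℕ) - 1 = 1 from rfl, pow_one, one_mul]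
  ring

/-- `1 − u² → 0⁺` along any filter finer than `𝓝 c` living on `(−1, 1)`, for `c = ±1`. [folklore] -/
theorem tendsto_one_sub_sq {c : ℝ} (hc : c ^ 2 = 1) {l : Filter ℝ} (hl : l ≤ 𝓝 c)
    (hI : Ioo (-1 : ℝ) 1 ∈ l) : Tendsto (fun u : ℝ => 1 - u ^ 2) l (𝓝[>] 0) := by
  refine tendsto_nhdsWithin_iff.2 ⟨?_, ?_⟩
  · have h : Tendsto (fun u : ℝ => 1 - u ^ 2) (𝓝 c) (𝓝 (1 - c ^ 2)) :=
      (continuous_const.sub (continuous_pow 2)).tendsto c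
    rw [hc, sub_self] at h
    exact h.mono_left hl
  · filter_upwards [hI] with u hu
    show 0 < 1 - u ^ 2
    nlinarith [hu.1, hu.2]

/-- `φ(u) → +∞` as `u → 1⁻`. [folklore] -/
theorem tendsto_phi_one : Tendsto (fun u : ℝ => u / (1 - u ^ 2)) (𝓝[<] 1) atTop := by
  have h3 : Tendsto (fun u : ℝ => u) (𝓝[<] (1 : ℝ)) (𝓝 1) := tendsto_id'.2 nhdsWithin_le_nhds
  simpa [div_eq_mul_inv] using h3.pos_mul_atTop one_pos (tendsto_inv_nhdsGT_zero.comp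
    (tendsto_one_sub_sq (by norm_num : (1 : ℝ) ^ 2 = 1) nhdsWithin_le_nhds
      (Ioo_mem_nhdsLT (show (-1 : ℝ) < 1 by norm_num))))

/-- `φ(u) → −∞` as `u → (−1)⁺`. [folklore] -/
theorem tendsto_phi_neg_one : Tendsto (fun u : ℝ => u / (1 - u ^ 2)) (𝓝[>] (-1)) atBot := by
  have h3 : Tendsto (fun u : ℝ => u) (𝓝[>] (-1 : ℝ)) (𝓝 (-1)) := tendsto_id'.2 nhdsWithin_le_nhds
  simpa [div_eq_mul_inv] using h3.neg_mul_atTop (by norm_num) (tendsto_inv_nhdsGT_zero.comp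
    (tendsto_one_sub_sq (by norm_num : (-1 : ℝ) ^ 2 = 1) nhdsWithin_le_nhds
      (Ioo_mem_nhdsGT (show (-1 : ℝ) < 1 by norm_num))))

/-- **The primitive on a closed fibre.** If `a : ℝ → ℝ` is continuous with `a → 0` at `±∞`, then the
extension by zero to `[−1, 1]` of `u ↦ a (φ u)` is continuous on `[−1, 1]`. [folklore] -/
theorem continuousOn_indicator_comp_phi {a : ℝ → ℝ} (ha : Continuous a)
    (htop : Tendsto a atTop (𝓝 0)) (hbot : Tendsto a atBot (𝓝 0)) :
    ContinuousOn ((Ioo (-1 : ℝ) 1).indicator fun u => a (u / (1 - u ^ 2))) (Icc (-1) 1) := by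
  have hIoo : ∀ u ∈ Ioo (-1 : ℝ) 1,
      ContinuousAt ((Ioo (-1 : ℝ) 1).indicator fun u => a (u / (1 - u ^ 2))) u := by
    intro u hu
    have hcont : ContinuousAt (fun u : ℝ => a (u / (1 - u ^ 2))) u :=
      ha.continuousAt.comp (hasDerivAt_phi hu).continuousAt
    refine hcont.congr_of_eventuallyEq ?_
    filter_upwards [Ioo_mem_nhds hu.1 hu.2] with s hs
    exact indicator_of_mem hs _
  intro u hu
  rcases hu.1.eq_or_lt with rfl | h1
  · -- the left wall `u = -1`: `a (φ u) → 0` as `u → (-1)⁺`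
    rw [continuousWithinAt_Icc_iff_Ici (show (-1 : ℝ) < 1 by norm_num),
      ← continuousWithinAt_Ioi_iff_Ici, ContinuousWithinAt,
      indicator_of_notMem (show (-1 : ℝ) ∉ Ioo (-1) 1 by simp)]
    refine (hbot.comp tendsto_phi_neg_one).congr' ?_
    filter_upwards [Ioo_mem_nhdsGT (show (-1 : ℝ) < 1 by norm_num)] with s hs
    rw [Function.comp_apply, indicator_of_mem hs]
  · rcases hu.2.eq_or_lt with rfl | h2
    · -- the right wall `u = 1`: `a (φ u) → 0` as `u → 1⁻`
      rw [continuousWithinAt_Icc_iff_Iic (show (-1 : ℝ) < 1 by norm_num),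
        ← continuousWithinAt_Iio_iff_Iic, ContinuousWithinAt,
        indicator_of_notMem (show (1 : ℝ) ∉ Ioo (-1) 1 by simp)]
      refine (htop.comp tendsto_phi_one).congr' ?_
      filter_upwards [Ioo_mem_nhdsLT (show (-1 : ℝ) < 1 by norm_num)] with s hs
      rw [Function.comp_apply, indicator_of_mem hs]
    · exact (hIoo u ⟨h1, h2⟩).continuousWithinAt

/-- The open band `{−1 < z last < 1}` is `ℚ`-semialgebraic. [cite: BCR1998, §2.1] -/
theorem isSemialgebraic_openBand :
    IsSemialgebraic ℚ {z : Fin (M + 1) → ℝ | -1 < z (Fin.last M) ∧ z (Fin.last M) < 1} := by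
  have h := (isSemialgebraic_setOf_eval_lt (k := ℚ) (R := ℝ) (C (-1) : MvPolynomial (Fin (M + 1)) ℚ)
    (X (Fin.last M))).inter (isSemialgebraic_setOf_eval_lt (k := ℚ) (R := ℝ)
      (X (Fin.last M) : MvPolynomial (Fin (M + 1)) ℚ) (C 1))
  simp only [MvPolynomial.aeval_X, map_neg, map_one] at h
  exact h

/-- The closed band `{−1 ≤ z last ≤ 1}` is `ℚ`-semialgebraic. [cite: BCR1998, §2.1] -/
theorem isSemialgebraic_closedBand :
    IsSemialgebraic ℚ {z : Fin (M + 1) → ℝ | -1 ≤ z (Fin.last M) ∧ z (Fin.last M) ≤ 1} := by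
  have h := (isSemialgebraic_setOf_eval_le (k := ℚ) (R := ℝ) (C (-1) : MvPolynomial (Fin (M + 1)) ℚ)
    (X (Fin.last M))).inter (isSemialgebraic_setOf_eval_le (k := ℚ) (R := ℝ)
      (X (Fin.last M) : MvPolynomial (Fin (M + 1)) ℚ) (C 1))
  simp only [MvPolynomial.aeval_X, map_neg, map_one] at h
  exact h

/-- On the open band the denominator `1 − (z last)²` does not vanish. [folklore] -/
theorem aeval_one_sub_sq_ne_zero (z : Fin (M + 1) → ℝ)
    (hz : z ∈ {z : Fin (M + 1) → ℝ | -1 < z (Fin.last M) ∧ z (Fin.last M) < 1}) :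
    MvPolynomial.aeval z (1 - X (Fin.last M) ^ 2 : MvPolynomial (Fin (M + 1)) ℚ) ≠ 0 := by
  have h : (0 : ℝ) < 1 - z (Fin.last M) ^ 2 := by nlinarith [hz.1, hz.2]
  simpa using h.ne'

/-- The chart `Φ` is a `ℚ`-semialgebraic map on the open band (coordinates and one rational
function with non-vanishing denominator; no Tarski–Seidenberg needed). [cite: BCR1998, §2.2] -/
theorem isSemialgebraicMapOn_chart :
    IsSemialgebraicMapOn ℚ {z : Fin (M + 1) → ℝ | -1 < z (Fin.last M) ∧ z (Fin.last M) < 1}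
      (fun z => Function.update z (Fin.last M)
        (z (Fin.last M) / (1 - z (Fin.last M) ^ 2))) := by
  have hD := isSemialgebraic_openBand (M := M)
  refine IsSemialgebraicMapOn.of_forall hD fun j => ?_
  by_cases hj : j = Fin.last M
  · subst hj
    simp only [Function.update_self]
    exact (isSemialgebraicFunOn_aeval_div_aeval hD (X (Fin.last M) : MvPolynomial (Fin (M + 1)) ℚ)
      (1 - X (Fin.last M) ^ 2) aeval_one_sub_sq_ne_zero).congr fun z _ => by simp
  · simp only [Function.update_of_ne hj]
    simpa using isSemialgebraicFunOn_aeval hD (X j : MvPolynomial (Fin (M + 1)) ℚ)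

/-- The Jacobian factor `φ'(z last) = (1 + (z last)²)/(1 − (z last)²)²` is a `ℚ`-semialgebraic
function on the open band. [cite: BCR1998, §2.2] -/
theorem isSemialgebraicFunOn_jac :
    IsSemialgebraicFunOn ℚ {z : Fin (M + 1) → ℝ | -1 < z (Fin.last M) ∧ z (Fin.last M) < 1}
      (fun z => (1 + z (Fin.last M) ^ 2) / (1 - z (Fin.last M) ^ 2) ^ 2) := by
  have hD := isSemialgebraic_openBand (M := M)
  refine (isSemialgebraicFunOn_aeval_div_aeval hD (1 + X (Fin.last M) ^ 2 : MvPolynomial (Fin (M + 1)) ℚ)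
    ((1 - X (Fin.last M) ^ 2) ^ 2) (fun z hz => ?_)).congr fun z _ => by simp
  rw [map_pow]
  exact pow_ne_zero 2 (aeval_one_sub_sq_ne_zero z hz)

/-- The chart is injective on the open band (`φ` is, and the other coordinates are kept).
[folklore] -/
theorem injOn_chart :
    InjOn (fun z : Fin (M + 1) → ℝ => Function.update z (Fin.last M)
        (z (Fin.last M) / (1 - z (Fin.last M) ^ 2)))
      {z : Fin (M + 1) → ℝ | -1 < z (Fin.last M) ∧ z (Fin.last M) < 1} := by
  intro x hx y hy hxy
  have hxy' : Function.update x (Fin.last M) (x (Fin.last M) / (1 - x (Fin.last M) ^ 2)) =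
      Function.update y (Fin.last M) (y (Fin.last M) / (1 - y (Fin.last M) ^ 2)) := hxy
  have hlast : x (Fin.last M) = y (Fin.last M) :=
    phi_injOn hx hy (by simpa using congrFun hxy' (Fin.last M))
  have key : ∀ z : Fin (M + 1) → ℝ, Function.update (Function.update z (Fin.last M)
      (z (Fin.last M) / (1 - z (Fin.last M) ^ 2))) (Fin.last M) (z (Fin.last M)) = z := fun z => by
    rw [Function.update_idem, Function.update_eq_self]
  rw [← key x, hxy', hlast, key y]

/-- The chart maps the open band ONTO `ℝᴹ⁺¹` (`φ` maps `(−1, 1)` onto `ℝ`). [folklore] -/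
theorem image_chart :
    (fun z : Fin (M + 1) → ℝ => Function.update z (Fin.last M)
        (z (Fin.last M) / (1 - z (Fin.last M) ^ 2))) ''
      {z : Fin (M + 1) → ℝ | -1 < z (Fin.last M) ∧ z (Fin.last M) < 1} = univ := by
  refine eq_univ_of_forall fun x => ?_
  obtain ⟨u, hu, hux⟩ := exists_phi_eq (x (Fin.last M))
  refine ⟨Function.update x (Fin.last M) u, by simpa using hu, ?_⟩
  simp only [Function.update_self, Function.update_idem, hux, Function.update_eq_self]

/-- The Jacobian `diag(1, …, 1, φ'(z last))` has absolute determinant `φ'(z last) ≥ 0`. [folklore] -/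
theorem abs_det_jac (z : Fin (M + 1) → ℝ) :
    |(LinearMap.toContinuousLinearMap (Matrix.toLin' (Matrix.diagonal fun i : Fin (M + 1) =>
        if i = Fin.last M then (1 + z (Fin.last M) ^ 2) / (1 - z (Fin.last M) ^ 2) ^ 2
        else (1 : ℝ)))).det| =
      (1 + z (Fin.last M) ^ 2) / (1 - z (Fin.last M) ^ 2) ^ 2 := by
  rw [LinearMap.det_toContinuousLinearMap, LinearMap.det_toLin', Matrix.det_diagonal,
    Finset.prod_ite_eq']
  simp only [Finset.mem_univ, if_true]
  exact abs_of_nonneg (by positivity)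

/-- The chart has derivative `diag(1, …, 1, φ'(z last))` at every point of the open band. [folklore] -/
theorem hasFDerivAt_chart {z : Fin (M + 1) → ℝ}
    (hz : z ∈ {z : Fin (M + 1) → ℝ | -1 < z (Fin.last M) ∧ z (Fin.last M) < 1}) :
    HasFDerivAt (fun x : Fin (M + 1) → ℝ => Function.update x (Fin.last M)
        (x (Fin.last M) / (1 - x (Fin.last M) ^ 2)))
      (LinearMap.toContinuousLinearMap (Matrix.toLin' (Matrix.diagonal fun i : Fin (M + 1) =>
        if i = Fin.last M then (1 + z (Fin.last M) ^ 2) / (1 - z (Fin.last M) ^ 2) ^ 2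
        else (1 : ℝ)))) z := by
  rw [hasFDerivAt_pi']
  intro i
  have happly : ∀ j : Fin (M + 1), HasFDerivAt (fun x : Fin (M + 1) → ℝ => x j)
      (ContinuousLinearMap.proj (R := ℝ) (φ := fun _ : Fin (M + 1) => ℝ) j) z :=
    fun j => hasFDerivAt_apply j z
  by_cases hi : i = Fin.last M
  · subst hi
    simp only [Function.update_self]
    refine ((hasDerivAt_phi hz).comp_hasFDerivAt z (happly (Fin.last M))).congr_fderiv
      (ContinuousLinearMap.ext fun v => ?_)
    simp [Matrix.mulVec_diagonal]
  · simp only [Function.update_of_ne hi]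
    refine (happly i).congr_fderiv (ContinuousLinearMap.ext fun v => ?_)
    simp [Matrix.mulVec_diagonal, hi]

/-- **Move 1 (rule (2)).** The honest pull-back `R₁ = [ℝᴹ × (−1, 1), φ'(u)·f(x, φ u)]` of a
representation `R = [ℝᴹ⁺¹, f]` along the chart exists, and `[R] − [R₁] ∈ KZ.relations`
(`tateLifting_pullback`). [cite: KontsevichZagier2001, §1.2 rule (2)] -/
theorem exists_pullback (R : KZ.IntegralRep (M + 1)) (hR : R.domain = univ) :
    ∃ R₁ : KZ.IntegralRep (M + 1),
      R₁.domain = {z : Fin (M + 1) → ℝ | -1 < z (Fin.last M) ∧ z (Fin.last M) < 1} ∧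
      (R₁.integrand = fun z => (1 + z (Fin.last M) ^ 2) / (1 - z (Fin.last M) ^ 2) ^ 2 *
        R.integrand (Function.update z (Fin.last M) (z (Fin.last M) / (1 - z (Fin.last M) ^ 2)))) ∧
      KZ.of R - KZ.of R₁ ∈ KZ.relations :=
  Summit.KontsevichZagierPeriods.InverseLandau.tateLifting_pullback (M + 1) R
    {z : Fin (M + 1) → ℝ | -1 < z (Fin.last M) ∧ z (Fin.last M) < 1}
    (fun z => Function.update z (Fin.last M) (z (Fin.last M) / (1 - z (Fin.last M) ^ 2)))
    (fun z => LinearMap.toContinuousLinearMap (Matrix.toLin' (Matrix.diagonal fun i : Fin (M + 1) =>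
      if i = Fin.last M then (1 + z (Fin.last M) ^ 2) / (1 - z (Fin.last M) ^ 2) ^ 2 else (1 : ℝ))))
    (fun z => (1 + z (Fin.last M) ^ 2) / (1 - z (Fin.last M) ^ 2) ^ 2)
    isSemialgebraic_openBand isSemialgebraicMapOn_chart
    (fun _ hz => (hasFDerivAt_chart hz).hasFDerivWithinAt) injOn_chart (image_chart.trans hR.symm)
    isSemialgebraicFunOn_jac fun z _ => (abs_det_jac z).symm

/-- **Move 2 (rule (1)).** Closing the band: a representation on the open band `ℝᴹ × (−1, 1)` whose
integrand is the pulled-back one extends, with the SAME integrand, to the closed band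
`ℝᴹ × [−1, 1]` (on the two walls the integrand is `0`, Lean's `x/0 = 0`), and the two differ by the
null walls. [cite: KontsevichZagier2001, §1.2 rule (1)] -/
theorem exists_closedBand (R R₁ : KZ.IntegralRep (M + 1))
    (hdom : R₁.domain = {z : Fin (M + 1) → ℝ | -1 < z (Fin.last M) ∧ z (Fin.last M) < 1})
    (hint : R₁.integrand = fun z => (1 + z (Fin.last M) ^ 2) / (1 - z (Fin.last M) ^ 2) ^ 2 *
        R.integrand (Function.update z (Fin.last M) (z (Fin.last M) / (1 - z (Fin.last M) ^ 2)))) :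
    ∃ R₂ : KZ.IntegralRep (M + 1),
      R₂.domain = {z : Fin (M + 1) → ℝ | -1 ≤ z (Fin.last M) ∧ z (Fin.last M) ≤ 1} ∧
      R₂.integrand = R₁.integrand ∧ KZ.of R₂ - KZ.of R₁ ∈ KZ.relations := by
  set D : Set (Fin (M + 1) → ℝ) := {z | -1 < z (Fin.last M) ∧ z (Fin.last M) < 1}
  set B : Set (Fin (M + 1) → ℝ) := {z | -1 ≤ z (Fin.last M) ∧ z (Fin.last M) ≤ 1}
  have hD : IsSemialgebraic ℚ D := isSemialgebraic_openBand
  have hB : IsSemialgebraic ℚ B := isSemialgebraic_closedBand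
  have hDB : D ⊆ B := fun z hz => ⟨hz.1.le, hz.2.le⟩
  -- the two walls are null, and `B ⊆ D ∪ walls`
  have hN : volume ({z : Fin (M + 1) → ℝ | z (Fin.last M) = -1} ∪ {z | z (Fin.last M) = 1}) = 0 :=
    measure_union_null (KZ.volume_setOf_last_eq_zero _) (KZ.volume_setOf_last_eq_zero _)
  have hBsub : B ⊆ D ∪ ({z : Fin (M + 1) → ℝ | z (Fin.last M) = -1} ∪ {z | z (Fin.last M) = 1}) := by
    intro z hz
    rcases hz.1.lt_or_eq with h1 | h1
    · rcases hz.2.lt_or_eq with h2 | h2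
      · exact Or.inl ⟨h1, h2⟩
      · exact Or.inr (Or.inr h2)
    · exact Or.inr (Or.inl h1.symm)
  -- on the walls the pulled-back integrand vanishes
  have hzero : ∀ z ∈ B, z ∉ D → R₁.integrand z = 0 := fun z hz hzD => by
    have h1 : z (Fin.last M) ^ 2 = 1 := by
      rcases hBsub hz with h | h | h
      · exact absurd h hzD
      all_goals rw [show z (Fin.last M) = _ from h]; norm_num
    rw [hint]
    simp [h1]
  have hsa : IsSemialgebraicFunOn ℚ B R₁.integrand := by
    have h := IsSemialgebraicFunOn.indicator hB hD
      (R₁.isSemialgebraicFunOn_integrand.mono (by rw [hdom]; exact inter_subset_right) (hB.inter hD))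
    refine h.congr fun z hz => ?_
    by_cases hzD : z ∈ D
    · exact indicator_of_mem hzD _
    · rw [indicator_of_notMem hzD, hzero z hz hzD]
  have hio : IntegrableOn R₁.integrand B := by
    have h0 := R₁.integrableOn
    rw [hdom] at h0
    exact (h0.union (IntegrableOn.of_measure_zero hN)).mono_set hBsub
  let R₂ : KZ.IntegralRep (M + 1) := ⟨B, R₁.integrand, hB, hsa, hio⟩
  have hvol : volume (R₂.domain \ D) = 0 :=
    measure_mono_null (fun z hz => (hBsub hz.1).resolve_left hz.2) hN
  have hrestr : R₂.restrict D hD hDB = R₁ :=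
    KZ.IntegralRep.ext' (by rw [KZ.IntegralRep.domain_restrict, hdom]) rfl
  have h := KZ.IntegralRep.of_sub_of_restrict_mem_relations R₂ hD hDB hvol
  rw [hrestr] at h
  exact ⟨R₂, rfl, rfl, h⟩

end WallFree

/-- **`WallFreeExactness`** (route SpheresForWalls, stmt-KontsevichZagierPeriods-16398): if `R` has
domain all of `ℝᴹ⁺¹` and its integrand is `∂ₜ A` along the last coordinate for a `ℚ`-semialgebraic
`A`, differentiable in `t` everywhere and tending to `0` as `t → ±∞` on every fibre, then
`[R] ∈ KZ.relations`: compactify the fibre by `t = u/(1 − u²)` (one change of variables), close the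
band (two null walls), make ONE Newton–Leibniz move on `ℝᴹ × [−1, 1]` with the primitive extended by
zero to the walls, and discard the base `[ℝᴹ, 0]`. [cite: KontsevichZagier2001, §1.2] -/
theorem wallFreeExactness_proof :
    Summit.KontsevichZagierPeriods.KontsevichZagierPeriods.Theses.SpheresForWalls.WallFreeExactness := by
  intro M R A hRdom hA hderiv htop hbot
  obtain ⟨R₁, hdom₁, hint₁, h₁⟩ := WallFree.exists_pullback R hRdom
  obtain ⟨R₂, hdom₂, hint₂, h₂⟩ := WallFree.exists_closedBand R R₁ hdom₁ hint₁
  obtain ⟨Z, hZd, hZi⟩ :=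
    KZ.exists_zeroRep (isSemialgebraic_univ : IsSemialgebraic ℚ (univ : Set (Fin M → ℝ)))
  have h₄ : KZ.of Z ∈ KZ.relations :=
    KZ.of_mem_relations_of_eqOn_zero Z (by rw [hZi]; exact fun _ _ => rfl)
  have hAcont : ∀ x : Fin M → ℝ, Continuous fun s : ℝ => A (Fin.snoc x s) := fun x =>
    continuous_iff_continuousAt.2 fun t => (hderiv x t).continuousAt
  -- the primitive `A ∘ Φ` on the open band, extended by zero to the walls
  set D : Set (Fin (M + 1) → ℝ) := {z | -1 < z (Fin.last M) ∧ z (Fin.last M) < 1} with hD_def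
  set G : (Fin (M + 1) → ℝ) → ℝ := D.indicator fun z =>
    A (Function.update z (Fin.last M) (z (Fin.last M) / (1 - z (Fin.last M) ^ 2))) with hG
  have hGfib : ∀ (x : Fin M → ℝ) (t : ℝ), G (Fin.snoc x t) =
      (Ioo (-1 : ℝ) 1).indicator (fun u => A (Fin.snoc x (u / (1 - u ^ 2)))) t := by
    intro x t
    by_cases ht : t ∈ Ioo (-1 : ℝ) 1
    · have hmem : (Fin.snoc x t : Fin (M + 1) → ℝ) ∈ D := by simpa [hD_def] using ht
      rw [hG, indicator_of_mem hmem, indicator_of_mem ht, Fin.snoc_last, Fin.update_snoc_last]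
    · have hmem : (Fin.snoc x t : Fin (M + 1) → ℝ) ∉ D := by simpa [hD_def] using ht
      rw [hG, indicator_of_notMem hmem, indicator_of_notMem ht]
  -- Move 3: ONE Newton–Leibniz move on the closed band, base `[ℝᴹ, 0]`
  have h₃ : KZ.of R₂ - KZ.of Z ∈ KZ.relations := by
    refine KZ.newtonLeibnizRel_subset_relations ⟨M, R₂, Z, fun _ => -1, fun _ => 1, G, ?_, ?_, ?_,
      fun _ _ => by norm_num, ?_, ?_, ?_, ?_, rfl⟩
    · rw [hdom₂]
      exact IsSemialgebraicFunOn.indicator WallFree.isSemialgebraic_closedBand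
        WallFree.isSemialgebraic_openBand ((IsSemialgebraicFunOn.comp_isSemialgebraicMapOn_holds hA
          WallFree.isSemialgebraicMapOn_chart (mapsTo_univ _ _)).mono inter_subset_right
          (WallFree.isSemialgebraic_closedBand.inter WallFree.isSemialgebraic_openBand))
    · simpa using isSemialgebraicFunOn_ratCast Z.isSemialgebraic_domain (-1)
    · simpa using isSemialgebraicFunOn_ratCast Z.isSemialgebraic_domain 1
    · rw [hdom₂, hZd]
      ext z
      simp
    · intro x _
      show ContinuousOn (fun t => G (Fin.snoc x t)) (Icc (-1) 1)
      simp only [hGfib]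
      exact WallFree.continuousOn_indicator_comp_phi (hAcont x) (htop x) (hbot x)
    · intro x _ t ht
      have ht' : t ∈ Ioo (-1 : ℝ) 1 := ht
      have hc := (hderiv x (t / (1 - t ^ 2))).comp t (WallFree.hasDerivAt_phi ht')
      have hev : (fun s => G (Fin.snoc x s)) =ᶠ[𝓝 t]
          ((fun s => A (Fin.snoc x s)) ∘ fun u => u / (1 - u ^ 2)) := by
        filter_upwards [Ioo_mem_nhds ht'.1 ht'.2] with s hs
        rw [hGfib, indicator_of_mem hs, Function.comp_apply]
      refine (hc.congr_of_eventuallyEq hev).congr_deriv ?_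
      rw [hint₂, hint₁]
      simp only [Fin.snoc_last, Fin.update_snoc_last]
      ring
    · intro x _
      show Z.integrand x = G (Fin.snoc x 1) - G (Fin.snoc x (-1))
      rw [hGfib, hGfib, hZi, indicator_of_notMem (show (1 : ℝ) ∉ Ioo (-1) 1 by simp),
        indicator_of_notMem (show (-1 : ℝ) ∉ Ioo (-1) 1 by simp)]
      simp
  have hsum : KZ.of R = (KZ.of R - KZ.of R₁) - (KZ.of R₂ - KZ.of R₁) + (KZ.of R₂ - KZ.of Z) +
      KZ.of Z := by abel
  rw [hsum]
  exact add_mem (add_mem (sub_mem h₁ h₂) h₃) h₄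

end Summit.KontsevichZagierPeriods.SpheresForWalls

end
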